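import Literature.Barriers.ValiantsHypothesis.NotViaSaturations
import Literature.Computability.Complexity.OccurrenceObstructionsIPSemigroup
import Literature.NumberTheory.DiophantineGeometry.SymmetricGroupRepsKroneckerSymmetryProofs
import Literature.NumberTheory.DiophantineGeometry.GLHighestWeightFacts
import Literature.Computability.QuantumComplexity.QuantumMarginals
import HarnessLib

/-!
# Bürgisser–Christandl–Ikenmeyer 2011, Thm. 1(2), from Klyachko's rational spectral theorem

Second companion of `Literature/Barriers/ValiantsHypothesis/NotViaSaturations.lean`, next to
`NotViaSaturationsProofs.lean` (Kumar's theorem); this one concerns the named fact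
`Literature.Barriers.ValiantsHypothesis.BCI2011_thm1`: "Let `λ ⊢ ℓd` be a partition into at most
`d²` parts for `ℓ, d ≥ 1` and let `□ := (ℓ,…,ℓ)` denote the rectangular partition of `ℓd` into `d`
parts. Then there exists a stretching factor `k ≥ 1` such that `g_{kλ,k□,k□} ≠ 0`."

**The printed proof** (BCI §5.1) rests on (a) "`Kron(d,d,d²)` is a rational polytope ... This
easily implies that a rational point in the closure actually lies in `Kron(d,d,d²)`", (b) the
spectral characterisation of that closure (§2.3: Christandl–Mitchison, Klyachko,
Christandl–Harrow–Mitchison), and (c) Prop. 2: an explicit density operator `ρ_{AB}` on `ℂ^d ⊗ ℂ^d`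
with any prescribed spectrum and both marginals uniform. Klyachko's theorem in the form of
Christandl–Harrow–Mitchison, Thm. 2.3 ("For a density operator `ρ^{AB}` with the rational spectral
triple `(r^A, r^B, r^{AB})` there is an integer `m > 0` such that `g_{m r^A, m r^B, m r^{AB}} ≠ 0`")
is exactly (a)+(b) specialised to rational points (Klyachko, *Quantum marginal problem and
representations of the symmetric group*, arXiv:quant-ph/0409113; proved there and in CHM via the
finite generation of the Kronecker semigroup, CHM Thm. 3.2, i.e. geometric invariant theory), and
(c) is the tree's PROVED
`Literature.Computability.QuantumComplexity.exists_isDensity_hasSpectrum_uniform_marginals`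
(`QuantumMarginals.lean`, which also supplies density operators `IsDensity`, spectra `HasSpectrum`
and the partial traces `traceLeft`, `traceRight`).

**This file proves** `BCI2011_thm1_of_klyachko : (Klyachko's theorem) → BCI2011_thm1`, the
hypothesis being CHM Thm. 2.3 written out in these terms (it is NOT vendored as a named fact here;
BCI Thm. 1(2) thus rests on that single published statement): with `ρ_{AB}` of spectrum `λ̄ = λ/(ℓd)` and
uniform marginals, Klyachko's theorem gives `k > 0` and `g(μ, ν, Λ) ≠ 0` with `μ = ν = (k/d)^d`
and `Λ = (k/(ℓd))·λ`; the `(ℓd)`-fold semigroup property of Christandl–Harrow–Mitchison (tree: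
`Literature.Computability.Complexity.ikenmeyerPanova2017_semigroup_holds`, from
`Literature.NumberTheory.DiophantineGeometry.kroneckerCoeff_pos_of_ofPartition_add`) then yields
`g(k□, k□, kλ) ≠ 0`, i.e. `g(kλ, k□, k□) ≠ 0` by the `S₃`-symmetry. On the way: the parts, rows and
weight of the stretched partition `kλ` (`partitionStretch` of the companion file;
`ofPartition_partitionStretch`: its weight is `k` times the weight of `λ`), the `k`-fold semigroup
property `kroneckerCoeff_pos_partitionStretch` ("stability", CHM §3: "if `g_{μνλ} ≠ 0` then
`g_{Nμ,Nν,Nλ} ≠ 0` for integers `N > 0`"), and its weight form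
`kroneckerCoeff_pos_of_ofPartition_eq_smul`.

## References

* P. Bürgisser, M. Christandl, C. Ikenmeyer, Adv. Math. 227 (2011) = arXiv:0910.4512, Thm. 1,
  §5.1. [BurgisserChristandlIkenmeyer2011]
* M. Christandl, A. W. Harrow, G. Mitchison, Comm. Math. Phys. 270 (2007), Thm. 2.3, Thm. 3.1
  (semigroup property and stability). [ChristandlHarrowMitchison2007]
-/

noncomputable section

open scoped BigOperators

namespace Literature.Barriers.ValiantsHypothesis

open Literature.NumberTheory.DiophantineGeometry Literature.Computability.Complexity
  Literature.Computability.QuantumComplexity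

/-! ### Sorted parts and weights across sizes -/

/-- Two partitions (of possibly differently written sizes) with at most `N` parts and the same
weight in `GL_N` have the same sorted parts (the weight lists the sorted parts, zero padded).
[folklore] -/
theorem sortedParts_eq_of_ofPartition_eq' {N n n' : ℕ} {μ : Nat.Partition n} {ν : Nat.Partition n'}
    (h : Weight.ofPartition N μ = Weight.ofPartition N ν) (hμ : μ.parts.card ≤ N)
    (hν : ν.parts.card ≤ N) : μ.sortedParts = ν.sortedParts := by
  -- the lengths agree: otherwise the longer list has a positive entry where the shorter is padded
  have hlen : ∀ {a a' : ℕ} {α : Nat.Partition a} {β : Nat.Partition a'},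
      Weight.ofPartition N α = Weight.ofPartition N β → β.parts.card ≤ N →
      β.sortedParts.length ≤ α.sortedParts.length := by
    intro a a' α β hab hβ
    by_contra hlt
    rw [not_le] at hlt
    have hi : α.sortedParts.length < N := lt_of_lt_of_le hlt (by simpa using hβ)
    have key := congrFun hab ⟨α.sortedParts.length, hi⟩
    simp only [Weight.ofPartition_apply, Nat.cast_inj, List.getD_eq_default _ _ le_rfl,
      List.getD_eq_getElem _ _ hlt] at key
    exact (β.pos_of_mem_sortedParts (List.getElem_mem hlt)).ne key
  have hl : μ.sortedParts.length = ν.sortedParts.length :=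
    le_antisymm (hlen h.symm hμ) (hlen h hν)
  refine List.ext_getElem hl fun i h₁ h₂ => ?_
  have hi : i < N := lt_of_lt_of_le h₁ (by simpa using hμ)
  have key := congrFun h ⟨i, hi⟩
  simpa only [Weight.ofPartition_apply, Nat.cast_inj, List.getD_eq_getElem _ _ h₁,
    List.getD_eq_getElem _ _ h₂] using key

/-- The parts of a partition are (the multiset of) its sorted parts. [folklore] -/
theorem coe_sortedParts {n : ℕ} (μ : Nat.Partition n) : (μ.sortedParts : Multiset ℕ) = μ.parts :=
  Multiset.sort_eq _ _

/-- Two partitions with at most `N` parts and the same weight in `GL_N` have the same parts.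
[folklore] -/
theorem parts_eq_of_ofPartition_eq' {N n n' : ℕ} {μ : Nat.Partition n} {ν : Nat.Partition n'}
    (h : Weight.ofPartition N μ = Weight.ofPartition N ν) (hμ : μ.parts.card ≤ N)
    (hν : ν.parts.card ≤ N) : μ.parts = ν.parts := by
  rw [← coe_sortedParts μ, ← coe_sortedParts ν, sortedParts_eq_of_ofPartition_eq' h hμ hν]

/-- The size of a partition is determined by its weight (with enough coordinates). [folklore] -/
theorem size_eq_of_ofPartition_eq {N n n' : ℕ} {μ : Nat.Partition n} {ν : Nat.Partition n'}
    (h : Weight.ofPartition N μ = Weight.ofPartition N ν) (hμ : μ.parts.card ≤ N)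
    (hν : ν.parts.card ≤ N) : n = n' := by
  rw [← μ.parts_sum, ← ν.parts_sum, parts_eq_of_ofPartition_eq' h hμ hν]

/-! ### The stretched partition `kλ` -/

section Stretch

variable {n : ℕ}

/-- The parts of `kλ`, `k ≥ 1`, are the parts of `λ` multiplied by `k`.
[cite: BurgisserChristandlIkenmeyer2011, §1 ("the partition arising by multiplying all components of λ by k")] -/
theorem parts_partitionStretch {k : ℕ} (hk : 0 < k) (lam : Nat.Partition n) :
    (partitionStretch k lam).parts = lam.parts.map (k * ·) := by
  rw [partitionStretch, Nat.Partition.ofSums_parts, Multiset.filter_eq_self]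
  intro a ha
  obtain ⟨b, hb, rfl⟩ := Multiset.mem_map.mp ha
  exact Nat.mul_ne_zero hk.ne' (lam.parts_pos hb).ne'

/-- `0λ` is the empty partition. [folklore] -/
theorem parts_partitionStretch_zero (lam : Nat.Partition n) : (partitionStretch 0 lam).parts = 0 := by
  rw [partitionStretch, Nat.Partition.ofSums_parts, Multiset.filter_eq_nil]
  intro a ha
  obtain ⟨b, -, rfl⟩ := Multiset.mem_map.mp ha
  simp

/-- The rows of `kλ`, `k ≥ 1`, are the rows of `λ` multiplied by `k`, in the same order.
[cite: BurgisserChristandlIkenmeyer2011, §1] -/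
theorem sortedParts_partitionStretch {k : ℕ} (hk : 0 < k) (lam : Nat.Partition n) :
    (partitionStretch k lam).sortedParts = lam.sortedParts.map (k * ·) := by
  have hsorted : (lam.sortedParts.map (k * ·)).Pairwise (· ≥ ·) :=
    (lam.sortedGE_sortedParts.pairwise).map _ fun {a b} (hab : a ≥ b) => Nat.mul_le_mul_left k hab
  have hp : (partitionStretch k lam).parts = ((lam.sortedParts.map (k * ·) : List ℕ) : Multiset ℕ) := by
    rw [parts_partitionStretch hk, ← Multiset.map_coe, coe_sortedParts]
  change (partitionStretch k lam).parts.sort (· ≥ ·) = _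
  rw [hp, Multiset.coe_sort]
  exact List.mergeSort_eq_self (r := (· ≥ ·)) hsorted

/-- `kλ` has as many parts as `λ` for `k ≥ 1` (and none for `k = 0`). [folklore] -/
theorem card_parts_partitionStretch_le (k : ℕ) (lam : Nat.Partition n) :
    (partitionStretch k lam).parts.card ≤ lam.parts.card := by
  rcases Nat.eq_zero_or_pos k with rfl | hk
  · rw [parts_partitionStretch_zero]; simp
  · rw [parts_partitionStretch hk, Multiset.card_map]

/-- **The weight of `kλ` is `k` times the weight of `λ`** (rows scale).
[cite: BurgisserChristandlIkenmeyer2011, §1] -/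
theorem ofPartition_partitionStretch (N k : ℕ) (lam : Nat.Partition n) :
    Weight.ofPartition N (partitionStretch k lam) = k • Weight.ofPartition N lam := by
  funext i
  rw [Pi.smul_apply, Weight.ofPartition_apply, Weight.ofPartition_apply, nsmul_eq_mul]
  rcases Nat.eq_zero_or_pos k with rfl | hk
  · have h0 : (partitionStretch 0 lam).sortedParts = [] := by
      rw [Nat.Partition.sortedParts, parts_partitionStretch_zero, Multiset.sort_zero]
    rw [h0]; simp
  · rw [sortedParts_partitionStretch hk]
    by_cases hi : (i : ℕ) < lam.sortedParts.length
    · rw [List.getD_eq_getElem _ _ (by simpa using hi), List.getElem_map,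
        List.getD_eq_getElem _ _ hi, Nat.cast_mul]
    · rw [List.getD_eq_default _ _ (by simpa using hi), List.getD_eq_default _ _ (not_lt.mp hi)]
      simp

/-- Stretching a rectangle stretches its width: the parts of `k(a × b)` are those of `a × kb`.
[cite: BurgisserChristandlIkenmeyer2011, Thm. 1 (`k□`)] -/
theorem parts_partitionStretch_rectangle (k a b : ℕ) :
    (partitionStretch k (Nat.Partition.rectangle a b)).parts = (Nat.Partition.rectangle a (k * b)).parts := by
  refine parts_eq_of_ofPartition_eq' (N := a) ?_
    ((card_parts_partitionStretch_le _ _).trans (Nat.Partition.card_parts_rectangle_le a b))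
    (Nat.Partition.card_parts_rectangle_le a (k * b))
  rw [ofPartition_partitionStretch, Weight.ofPartition_rectangle, Weight.ofPartition_rectangle]
  funext i
  simp

end Stretch

/-! ### Stability: the `k`-fold semigroup property -/

/-- **Stability of nonvanishing Kronecker coefficients** (Christandl–Harrow–Mitchison §3: the
semigroup property "implies stability of the Kronecker coefficients: i.e. if `g_{μνλ} ≠ 0` then
`g_{Nμ,Nν,Nλ} ≠ 0`, for integers `N > 0`"): `g(λ, μ, ν) > 0 ⇒ g(kλ, kμ, kν) > 0` (over `ℂ`;
for `k = 0` all three are the empty partition and `g = 1`). By induction on `k` from the tree's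
semigroup property in row-sum form. [cite: ChristandlHarrowMitchison2007, Thm. 3.1 (and the stability remark after it)] -/
theorem kroneckerCoeff_pos_partitionStretch {n : ℕ} (k : ℕ) {lam mu nu : Nat.Partition n}
    (h : 0 < kroneckerCoeff ℂ lam mu nu) :
    0 < kroneckerCoeff ℂ (partitionStretch k lam) (partitionStretch k mu) (partitionStretch k nu) := by
  induction k with
  | zero => exact kroneckerCoeff_pos_of_eq_zero (by simp) _ _ _
  | succ k ih =>
    have hs := ikenmeyerPanova2017_semigroup_holds _ _ _ _ _ _ ih h
    -- transport `(kλ) + λ` to `(k+1)λ` along their common weight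
    have hw : ∀ ρ : Nat.Partition n,
        ((partitionStretch k ρ).rowAdd ρ).parts = (partitionStretch (k + 1) ρ).parts := by
      intro ρ
      refine parts_eq_of_ofPartition_eq' (N := n) ?_
        ((card_parts_rowAdd_le _ _).trans (max_le ((card_parts_partitionStretch_le _ _).trans
          ρ.card_parts_le_size) ρ.card_parts_le_size))
        ((card_parts_partitionStretch_le _ _).trans ρ.card_parts_le_size)
      rw [ofPartition_rowAdd, ofPartition_partitionStretch, ofPartition_partitionStretch, succ_nsmul]
    rwa [kroneckerCoeff_congr_parts (by ring : k * n + n = (k + 1) * n) (hw lam) (hw mu) (hw nu)] at hs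

/-- **Stability in weight form**: if `Λ, Μ, Ν` have `K` times the weights of `λ, μ, ν ⊢ n` (all with
at most `N` parts, `Λ, Μ, Ν` of a common size `M = K n`) and `g(λ, μ, ν) > 0`, then
`g(Λ, Μ, Ν) > 0`. [cite: ChristandlHarrowMitchison2007, Thm. 3.1 (stability)] -/
theorem kroneckerCoeff_pos_of_ofPartition_eq_smul (N K : ℕ) {n M : ℕ} (hM : M = K * n)
    {lam mu nu : Nat.Partition n} {Lam Mu Nu : Nat.Partition M}
    (hl : lam.parts.card ≤ N) (hm : mu.parts.card ≤ N) (hn : nu.parts.card ≤ N)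
    (hL : Lam.parts.card ≤ N) (hMu : Mu.parts.card ≤ N) (hNu : Nu.parts.card ≤ N)
    (eL : Weight.ofPartition N Lam = K • Weight.ofPartition N lam)
    (eM : Weight.ofPartition N Mu = K • Weight.ofPartition N mu)
    (eN : Weight.ofPartition N Nu = K • Weight.ofPartition N nu)
    (h : 0 < kroneckerCoeff ℂ lam mu nu) : 0 < kroneckerCoeff ℂ Lam Mu Nu := by
  subst hM
  have hp : ∀ {ρ : Nat.Partition n} {P : Nat.Partition (K * n)}, ρ.parts.card ≤ N →
      P.parts.card ≤ N → Weight.ofPartition N P = K • Weight.ofPartition N ρ →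
      (partitionStretch K ρ).parts = P.parts := by
    intro ρ P hρ hP e
    exact parts_eq_of_ofPartition_eq' (N := N) (by rw [ofPartition_partitionStretch, e])
      ((card_parts_partitionStretch_le _ _).trans hρ) hP
  rw [← kroneckerCoeff_congr_parts rfl (hp hl hL eL) (hp hm hMu eM) (hp hn hNu eN)]
  exact kroneckerCoeff_pos_partitionStretch K h

/-! ### BCI Thm. 1(2) from Klyachko's theorem -/

/-- Entries of the weight of a partition with at most `N ≤ i` parts vanish at `i`. [folklore] -/
theorem ofPartition_apply_eq_zero_of_le {N' n : ℕ} (μ : Nat.Partition n) {N : ℕ}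
    (hμ : μ.parts.card ≤ N) (i : Fin N') (hi : N ≤ (i : ℕ)) : Weight.ofPartition N' μ i = 0 := by
  rw [Weight.ofPartition_apply, List.getD_eq_default _ _ (by
    rw [Nat.Partition.length_sortedParts]; exact hμ.trans hi), Nat.cast_zero]

/-- **Bürgisser–Christandl–Ikenmeyer 2011, Thm. 1(2), from Klyachko's rational spectral theorem**
(the printed proof, BCI §5.1, with Christandl–Harrow–Mitchison Thm. 2.3 supplying "rational points
of the closure lie in `Kron`"). The hypothesis `hK` is CHM Thm. 2.3 (Klyachko): "For a density
operator `ρ^{AB}` with the rational spectral triple `(r^A, r^B, r^{AB})` there is an integer `m > 0`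
such that `g_{m r^A, m r^B, m r^{AB}} ≠ 0`" — `ρ` a density operator on `ℂ^a ⊗ ℂ^b` (matrices on
`Fin a × Fin b`), its spectral triple the decreasingly ordered rational spectra `rA, rB, rAB` of
`ρ_A = tr_B ρ`, `ρ_B = tr_A ρ` and of `ρ` (listed along `Fin a × Fin b ≃ Fin (a·b)`), and the
conclusion a `k > 0` with partitions `μ, ν, Λ ⊢ k` of weights `k·rA, k·rB, k·rAB` (at most `a`, `b`,
`a·b` parts) and `g(μ, ν, Λ) ≠ 0` for the tree's `kroneckerCoeff ℂ`. Proof: for `λ ⊢ ℓd` with at most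
`d²` parts, the density operator of BCI Prop. 2 with spectrum `λ̄` and uniform marginals has the
rational spectral triple `(u_d, u_d, λ̄)`, so `g((k/d)^d, (k/d)^d, (k/ℓd)λ) ≠ 0` for some `k > 0`;
stretching by `ℓd` (stability) gives `g(k□, k□, kλ) ≠ 0`, and `g` is symmetric.
[cite: BurgisserChristandlIkenmeyer2011, Thm. 1(2) and §5.1] -/
theorem BCI2011_thm1_of_klyachko
    (hK : ∀ (a b : ℕ) [NeZero a] [NeZero b] (ρ : Matrix (Fin a × Fin b) (Fin a × Fin b) ℂ),
      IsDensity ρ → ∀ (rA : Fin a → ℚ) (rB : Fin b → ℚ) (rAB : Fin (a * b) → ℚ),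
      Antitone rA → Antitone rB → Antitone rAB →
      HasSpectrum (traceRight ρ) (fun i => (rA i : ℝ)) →
      HasSpectrum (traceLeft ρ) (fun i => (rB i : ℝ)) →
      HasSpectrum ρ (fun p => (rAB (finProdFinEquiv p) : ℝ)) →
      ∃ k : ℕ, 0 < k ∧ ∃ (μ : Nat.Partition k) (ν : Nat.Partition k) (Λ : Nat.Partition k),
        μ.parts.card ≤ a ∧ ν.parts.card ≤ b ∧ Λ.parts.card ≤ a * b ∧
        (∀ i, (Weight.ofPartition a μ i : ℚ) = k * rA i) ∧
        (∀ i, (Weight.ofPartition b ν i : ℚ) = k * rB i) ∧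
        (∀ i, (Weight.ofPartition (a * b) Λ i : ℚ) = k * rAB i) ∧
        kroneckerCoeff ℂ μ ν Λ ≠ 0) :
    BCI2011_thm1 := by
  intro ℓ d hℓ hd lam hlam
  haveI : NeZero d := ⟨by omega⟩
  have hdℓ : (0 : ℚ) < (d * ℓ : ℕ) := by exact_mod_cast Nat.mul_pos hd hℓ
  have hd0 : (d : ℚ) ≠ 0 := by exact_mod_cast (NeZero.ne d)
  have hdℓ0 : ((d * ℓ : ℕ) : ℚ) ≠ 0 := hdℓ.ne'
  have hlamN : lam.parts.card ≤ d * d := by simpa [sq] using hlam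
  -- the rational spectral triple `(u_d, u_d, λ̄)`
  set w : Weight (Fin (d * d)) := Weight.ofPartition (d * d) lam with hw
  let rAB : Fin (d * d) → ℚ := fun i => (w i : ℚ) / (d * ℓ : ℕ)
  let rA : Fin d → ℚ := fun _ => (d : ℚ)⁻¹
  let r : Fin d × Fin d → ℝ := fun p => (rAB (finProdFinEquiv p) : ℝ)
  have hwpoly := Weight.isPolynomial_ofPartition_holds (d * d) lam
  have hw0 : ∀ i, 0 ≤ w i := hwpoly.2
  have hr0 : ∀ p, 0 ≤ r p := fun p => by
    have h1 : (0 : ℚ) ≤ rAB (finProdFinEquiv p) :=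
      div_nonneg (Int.cast_nonneg (hw0 _)) hdℓ.le
    show (0 : ℝ) ≤ ((rAB (finProdFinEquiv p) : ℚ) : ℝ)
    exact_mod_cast h1
  have hwsum : ∑ i, w i = (d * ℓ : ℕ) := Weight.size_ofPartition_holds hlamN
  have hr1 : ∑ p, r p = 1 := by
    change ∑ p, (((fun i => (w i : ℚ) / (d * ℓ : ℕ)) (finProdFinEquiv p) : ℚ) : ℝ) = 1
    rw [Equiv.sum_comp finProdFinEquiv (fun i => (((w i : ℚ) / (d * ℓ : ℕ) : ℚ) : ℝ))]
    have h1 : ∑ i, ((w i : ℚ) / (d * ℓ : ℕ)) = 1 := by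
      rw [← Finset.sum_div, div_eq_one_iff_eq hdℓ.ne']
      exact_mod_cast hwsum
    exact_mod_cast congrArg (fun q : ℚ => (q : ℝ)) h1
  have hanti : Antitone rAB := fun i j hij =>
    div_le_div_of_nonneg_right (by exact_mod_cast hwpoly.1 hij) hdℓ.le
  have hantiA : Antitone rA := fun _ _ _ => le_rfl
  -- the density operator of Prop. 2 and its marginals
  obtain ⟨ρ, hρ, hspec, hR, hL⟩ := exists_isDensity_hasSpectrum_uniform_marginals hr0 hr1
  have hcast : ((((d : ℚ)⁻¹ : ℚ) : ℝ) : ℂ) = (d : ℂ)⁻¹ := by push_cast; rfl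
  have hA : HasSpectrum (traceRight ρ) (fun i => (rA i : ℝ)) := by
    rw [hR, ← hcast]; exact hasSpectrum_uniform _
  have hB : HasSpectrum (traceLeft ρ) (fun i => (rA i : ℝ)) := by
    rw [hL, ← hcast]; exact hasSpectrum_uniform _
  obtain ⟨k, hk, μ, ν, Λ, hμ, hν, hΛ, eμ, eν, eΛ, hg⟩ :=
    hK d d ρ hρ rA rA rAB hantiA hantiA hanti hA hB hspec
  -- stretch by `ℓd`
  have hdk : ∀ {π : Nat.Partition k}, π.parts.card ≤ d →
      (∀ i : Fin d, (Weight.ofPartition d π i : ℚ) = k * rA i) →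
      Weight.ofPartition (d * d) (partitionStretch k (Nat.Partition.rectangle d ℓ)) =
        (d * ℓ) • Weight.ofPartition (d * d) π := by
    intro π hπ e
    funext i
    rw [ofPartition_partitionStretch, Pi.smul_apply, Pi.smul_apply, nsmul_eq_mul, nsmul_eq_mul]
    by_cases hi : (i : ℕ) < d
    · have e' := e ⟨i, hi⟩
      have h1 : Weight.ofPartition (d * d) π i = Weight.ofPartition d π ⟨i, hi⟩ := rfl
      have h2 : Weight.ofPartition (d * d) (Nat.Partition.rectangle d ℓ) i = ℓ := by
        rw [Weight.ofPartition_apply, Nat.Partition.sortedParts_rectangle d ℓ (by omega),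
          List.getD_eq_getElem _ _ (by simpa using hi), List.getElem_replicate]
      have e2 : (Weight.ofPartition d π ⟨i, hi⟩ : ℚ) * d = k := by
        rw [e']
        show (k : ℚ) * (d : ℚ)⁻¹ * d = k
        field_simp
      have e3 : Weight.ofPartition d π ⟨i, hi⟩ * d = k := by exact_mod_cast e2
      rw [h1, h2, ← e3]
      push_cast
      ring
    · rw [ofPartition_apply_eq_zero_of_le _ hπ i (not_lt.mp hi),
        ofPartition_apply_eq_zero_of_le _ (Nat.Partition.card_parts_rectangle_le d ℓ) i (not_lt.mp hi)]
      simp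
  have hΛw : Weight.ofPartition (d * d) (partitionStretch k lam) =
      (d * ℓ) • Weight.ofPartition (d * d) Λ := by
    funext i
    rw [ofPartition_partitionStretch, Pi.smul_apply, Pi.smul_apply, nsmul_eq_mul, nsmul_eq_mul]
    have e' := eΛ i
    have e2 : (Weight.ofPartition (d * d) Λ i : ℚ) * (d * ℓ : ℕ) = k * w i := by
      rw [e']
      show (k : ℚ) * ((w i : ℚ) / (d * ℓ : ℕ)) * (d * ℓ : ℕ) = k * w i
      field_simp
    have e3 : Weight.ofPartition (d * d) Λ i * (d * ℓ : ℕ) = k * w i := by exact_mod_cast e2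
    rw [← hw, ← e3]
    push_cast
    ring
  have hpos : 0 < kroneckerCoeff ℂ μ ν Λ := Nat.pos_of_ne_zero hg
  have hstretch := kroneckerCoeff_pos_of_ofPartition_eq_smul (d * d) (d * ℓ) (by ring)
    (Lam := partitionStretch k (Nat.Partition.rectangle d ℓ))
    (Mu := partitionStretch k (Nat.Partition.rectangle d ℓ)) (Nu := partitionStretch k lam)
    (hμ.trans (Nat.le_mul_self d)) (hν.trans (Nat.le_mul_self d)) hΛ
    ((card_parts_partitionStretch_le _ _).trans ((Nat.Partition.card_parts_rectangle_le d ℓ).trans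
      (Nat.le_mul_self d)))
    ((card_parts_partitionStretch_le _ _).trans ((Nat.Partition.card_parts_rectangle_le d ℓ).trans
      (Nat.le_mul_self d)))
    ((card_parts_partitionStretch_le _ _).trans hlamN) (hdk hμ eμ) (hdk hν eν) hΛw hpos
  refine ⟨k, hk, ?_⟩
  rw [kroneckerCoeff_comm₁₂_holds, kroneckerCoeff_comm₂₃_holds]
  exact hstretch.ne'

end Literature.Barriers.ValiantsHypothesis
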